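import Summits.ResolutionOfSingularities.ResolutionOfSingularities.Theorems.WeightedInvariantIota3TauDescentAdapt
import Literature.AlgebraicGeometry.Resolution.RegularCentreRsopPart
import HarnessLib

/-!
# (desc-τ), CASE B AT WEIGHTS `(1, 1)` UNCONDITIONALLY: a regular system of parameters adapted to the curve `P₀` always exists
# (door `HypersurfaceCentreConstruction`, stmt-ResolutionOfSingularities-19897; gap (1) (desc-τ), item (ADAPT-rsp) of the memo TAU-DESCENT-A.md §6)

Topic: `Summits/ResolutionOfSingularities/ResolutionOfSingularities/Theorems`. Helper for the door item `HypersurfaceCentreConstruction`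
(stmt-ResolutionOfSingularities-19897, route `WeightedInvariant`), line `local-engine`, def-free.

* **`Iota3.exists_rsp_adapted`** — (ADAPT-rsp): in a regular local ring `T` of dimension three, a prime `P` with `T ⧸ P` regular of dimension one is generated
  by two members `x, y` of a regular system of parameters `(x, y, z)` (Matsumura 14.2 in the `IsRsopPart` form of the Literature,
  `exists_isRsopPart_span_range_eq`, plus the dimension count `dim T⧸P + r = dim T`).
* `Iota3.ringKrullDim_quotient_topStratumPrime_eq_one_of_isTiePosition_map` — at equal dimension three, a tie upstairs makes `(T, g)` a CURVE-centre position
  (`dim T ⧸ P₀ = 1`): a point centre would extend to the point centre `𝔪'` upstairs, a divisorial one would make `g` of monomial type.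
* **`Iota3.isTiePosition_descent_of_weights_one`** — equal-dimension descent of tie positions, OUTRIGHT, whenever the tie upstairs has a presentation of
  weights `q = r = 1` (`isTiePosition_of_adapted_rsp_of_weights_one` ∘ `exists_rsp_adapted`).

[OURS · L1 W4.3 · (desc-τ) case B, (ADAPT-rsp) + weights (1,1)]  Replaces the role of NO printed item; NOT a statement of the manuscript under review
[claim: Hironaka2017, status: under-review]; candidates stay candidates; AI work, weaker than expert review.  No definition; no axiom.

## References

* H. Matsumura, *Commutative Ring Theory* (1986), Thm. 14.2. [Matsumura1987]
* D. Abramovich, M. H. Quek, B. Schober, arXiv:2507.01232 (2025), Thm 3.5. [AbramovichQuekSchober2025]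
-/

noncomputable section

set_option linter.dupNamespace false -- mandated namespace `Summit.<Summit>.<Problem>` of this single-conjunct summit

open IsLocalRing Literature.AlgebraicGeometry.Resolution
open Summit.ResolutionOfSingularities.ResolutionOfSingularities.Theorems
open Summit.ResolutionOfSingularities.ResolutionOfSingularities.Theorems.ContactCylinder

namespace Summit.ResolutionOfSingularities.ResolutionOfSingularities.Cruxes.HypersurfaceCentreConstruction.LocalEngine

namespace Iota3

/-! ## §1 A regular system of parameters adapted to a regular curve -/

/-- **(ADAPT-rsp)**: in a regular local ring `T` of dimension three, a prime `P` with `T ⧸ P` regular of dimension one is `(x, y)` for a regular system of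
parameters `(x, y, z)` of `T`. [cite: Matsumura1987, Thm. 14.2] -/
theorem exists_rsp_adapted {T : Type} [CommRing T] [IsRegularLocalRing T] (hdim : ringKrullDim T = (3 : ℕ)) (P : Ideal T)
    [hreg : IsRegularLocalRing (T ⧸ P)] (hP1 : ringKrullDim (T ⧸ P) = 1) :
    ∃ x y z : T, Ideal.span {x, y, z} = maximalIdeal T ∧ Ideal.span {x, y} = P := by
  classical
  have hPtop : P ≠ ⊤ := by
    intro h
    haveI : Nontrivial (T ⧸ P) := inferInstance
    exact (Ideal.Quotient.zero_ne_one_iff.mp (zero_ne_one' (T ⧸ P))) h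
  have hPm : P ≤ maximalIdeal T := IsLocalRing.le_maximalIdeal hPtop
  obtain ⟨r, c, hc, hspan⟩ := exists_isRsopPart_span_range_eq hPm
  -- `r = 2`
  have hadd := hc.ringKrullDim_quotient_add
  rw [hspan, hP1, hdim] at hadd
  have hr : r = 2 := by
    have h : ((1 + r : ℕ) : WithBot ℕ∞) = ((3 : ℕ) : WithBot ℕ∞) := by
      rw [Nat.cast_add]; exact_mod_cast hadd
    have h' : 1 + r = 3 := by exact_mod_cast h
    omega
  subst hr
  -- complete `c` to a regular system of parameters `(c, y)` with `y : Fin 1 → T`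
  obtain ⟨_, e, y, hdim', hspan'⟩ := hc
  have he : e = 1 := by
    rw [hdim] at hdim'
    have h : (3 : ℕ) = 2 + e := by exact_mod_cast hdim'
    omega
  subst he
  have hrc : Set.range c = {c 0, c 1} := by
    ext t
    simp only [Set.mem_range, Set.mem_insert_iff, Set.mem_singleton_iff, Fin.exists_fin_two]
    constructor
    · rintro (h | h) <;> [exact Or.inl h.symm; exact Or.inr h.symm]
    · rintro (h | h) <;> [exact Or.inl h.symm; exact Or.inr h.symm]
  have hry : Set.range y = {y 0} := by
    ext t
    simp only [Set.mem_range, Set.mem_singleton_iff, Fin.exists_fin_one]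
    exact ⟨fun h => h.symm, fun h => h.symm⟩
  refine ⟨c 0, c 1, y 0, ?_, by rw [← hspan, hrc]⟩
  rw [← hspan', hrc, hry]
  congr 1
  ext t
  simp only [Set.mem_insert_iff, Set.mem_singleton_iff, Set.mem_union]
  tauto

/-! ## §2 A tie upstairs makes the position downstairs a curve-centre position -/

section CaseB

variable (T T' : Type) [CommRing T] [CommRing T'] [IsRegularLocalRing T] [IsRegularLocalRing T'] [Algebra T T']
  [IsLocalHom (algebraMap T T')] [Algebra.FormallySmooth T T'] [Algebra.EssFiniteType T T']

/-- **At equal dimension three a tie upstairs makes `(T, g)` a curve-centre position**: `dim T ⧸ P₀(T, g) = 1`. [OURS] -/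
theorem ringKrullDim_quotient_topStratumPrime_eq_one_of_isTiePosition_map (hdimT : ringKrullDim T = (3 : ℕ)) {g : T}
    (ht' : IsTiePosition T' (algebraMap T T' g)) :
    ringKrullDim (T ⧸ topStratumPrime iotaOrdEps T g) = 1 := by
  obtain ⟨hdimT'n, -⟩ := ringKrullDim_eq_of_isTiePosition_map T T' ht'
  have hdim3 : ringKrullDim T = 3 := by rw [hdimT]; rfl
  have h𝔪 : (maximalIdeal T).map (algebraMap T T') = maximalIdeal T' :=
    EssSmoothLE2.map_maximalIdeal_eq_of_ringKrullDim_eq T T' (by rw [hdimT, hdimT'n])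
  have hg0 : g ≠ 0 := fun h0 => ht'.ne_zero (by rw [h0, map_zero])
  have hg𝔪 : g ∈ maximalIdeal T := by
    refine (IsLocalRing.mem_maximalIdeal g).mpr (mem_nonunits_iff.mpr fun hu => ?_)
    exact (IsLocalRing.mem_maximalIdeal _).mp ht'.mem_maximalIdeal (hu.map (algebraMap T T'))
  have hnm : ¬ IsMonomialType g := not_isMonomialType_of_isTiePosition_map T T' ht'
  rcases point_or_curve_or_divisorial (le_of_eq hdim3) hg0 hg𝔪 with hpt | hcurve | hdiv
  · -- a point centre downstairs extends to the point centre `𝔪'` upstairs: no tie there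
    exfalso
    obtain ⟨ν, hgν, hgν1⟩ : ∃ ν : ℕ, g ∈ maximalIdeal T ^ ν ∧ g ∉ maximalIdeal T ^ (ν + 1) := by
      obtain ⟨_, -, -, -, _, _, _, _, _, _, hpres⟩ := id ht'
      obtain ⟨-, -, ν, -, hfν, hfν1, -, -⟩ := hpres
      exact ⟨ν, mem_pow_and_not_mem_of_map T T' hfν hfν1⟩
    have hν : iotaOrd T g = ν := (iotaOrd_eq_natCast_iff T g ν).mpr ⟨hgν, hgν1⟩
    obtain ⟨hP₀p, hreg, -, hE, -, -⟩ := topStratumPrime_iotaOrdEps_spec (le_of_eq hdim3) hg0 hg𝔪 hν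
    obtain ⟨-, -, -, hP₀map⟩ := topStratumPrime_iotaOrdEps_map_eq T T' g hreg hE
    obtain ⟨_, -, -, hq1', -⟩ := id ht'
    have hpt' : topStratumPrime iotaOrdEps T' (algebraMap T T' g) = maximalIdeal T' := by
      rw [hP₀map, show topStratumPrime iotaOrdEps T g = maximalIdeal T from hpt, h𝔪]
    have hcongr : ∀ (I J : Ideal T'), I = J → ringKrullDim (T' ⧸ I) = ringKrullDim (T' ⧸ J) := by rintro I J rfl; rfl
    rw [hcongr _ _ hpt'] at hq1'
    haveI : IsField (T' ⧸ maximalIdeal T') := (Ideal.Quotient.maximal_ideal_iff_isField_quotient _).mp inferInstance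
    rw [ringKrullDim_eq_zero_of_isField ‹_›] at hq1'
    exact zero_ne_one hq1'
  · rw [hcurve.2]; rfl
  · exact absurd (isMonomialType_of_isDivisorialPosition (le_of_eq hdim3) hg0 hg𝔪 hdiv) hnm

/-- **EQUAL-DIMENSION DESCENT OF TIE POSITIONS AT WEIGHTS `(1, 1)`, UNCONDITIONALLY.**  `φ : T → T'` local, formally smooth, essentially of finite type,
regular local rings of dimension three (so `𝔪_T T' = 𝔪'`); if `(T', φ g)` admits a tie presentation of weights `q = r = 1`, then `(T, g)` is a tie position.
[OURS · (desc-τ) case B, weights (1,1)] [cite: AbramovichQuekSchober2025, Thm 3.5] -/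
theorem isTiePosition_descent_of_weights_one (hdimT : ringKrullDim T = (3 : ℕ)) {g : T} (ht' : IsTiePosition T' (algebraMap T T' g))
    {x' y' z' : T'} {lam' : T'} (h' : IsTiePresentation T' (algebraMap T T' g) x' y' z' 1 1 lam') : IsTiePosition T g := by
  have hdim3 : ringKrullDim T = 3 := by rw [hdimT]; rfl
  have hg0 : g ≠ 0 := fun h0 => ht'.ne_zero (by rw [h0, map_zero])
  have hg𝔪 : g ∈ maximalIdeal T := by
    refine (IsLocalRing.mem_maximalIdeal g).mpr (mem_nonunits_iff.mpr fun hu => ?_)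
    exact (IsLocalRing.mem_maximalIdeal _).mp ht'.mem_maximalIdeal (hu.map (algebraMap T T'))
  obtain ⟨-, -, ν, -, hfν, hfν1, -, -⟩ := id h'
  obtain ⟨hgν, hgν1⟩ := mem_pow_and_not_mem_of_map T T' hfν hfν1
  have hν : iotaOrd T g = ν := (iotaOrd_eq_natCast_iff T g ν).mpr ⟨hgν, hgν1⟩
  obtain ⟨hP₀p, hreg, -, -, -, -⟩ := topStratumPrime_iotaOrdEps_spec (le_of_eq hdim3) hg0 hg𝔪 hν
  haveI := hP₀p
  haveI := hreg
  have hq1 := ringKrullDim_quotient_topStratumPrime_eq_one_of_isTiePosition_map T T' hdimT ht'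
  obtain ⟨x, y, z, hxyz, hxy⟩ := exists_rsp_adapted hdimT (topStratumPrime iotaOrdEps T g) hq1
  haveI hP : (Ideal.span ({x, y} : Set T)).IsPrime := hxy ▸ hP₀p
  exact isTiePosition_of_adapted_rsp_of_weights_one T T' hdimT ht' h' hxyz hxy.symm

end CaseB

end Iota3

end Summit.ResolutionOfSingularities.ResolutionOfSingularities.Cruxes.HypersurfaceCentreConstruction.LocalEngine

end
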